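import Summits.BirchSwinnertonDyer.BirchSwinnertonDyer.Theorems.ThetaPartnerAtTwoSignedMainConjectureCMTwoRankZeroPTDeepCoprimeRes
import Summits.BirchSwinnertonDyer.BirchSwinnertonDyer.Theorems.ThetaPartnerAtTwoSignedMainConjectureCMTwoRankZeroPTDeepLocalIndexCoprimeTower
import Literature.NumberTheory.EllipticCurves.Kobayashi2003.FineSelmerLeSignedSelmerProofs
import Literature.NumberTheory.EllipticCurves.Greenberg1999.ControlLocalKernelsLayerGoodProofs
import Literature.NumberTheory.EllipticCurves.CyclotomicLocalTorsionDivisibleProofs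
import Literature.NumberTheory.EllipticCurves.SelmerCorankAssembly
import HarnessLib

/-!
# Route `ThetaPartnerAtTwo` (TP2), crux K2R0P♭ (stmt-BirchSwinnertonDyer-26471; derived node K2r0P 24945), line `rankzero` v19,
# stub `stub_poitouTateDeepTwoGen` = (S_PT) — brick **B5b, part 1** of `Cruxes/SignedMainConjectureCMTwoRankZeroOfPub/PT-DEEP-HALF-DESIGN-w2g4.md` §7:
# **«unramified ⟹ locally trivial over `K_∞` at `v ∤ p`»** (Greenberg, LNM 1716, §2 p. 70: `Gal((K_∞)_η^{unr}/(K_∞)_η)` has profinite order prime to `p`,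
# so `H¹` of it with `p`-primary coefficients vanishes) — assembled from B5a′ (`…PTDeepCoprimeRes`) and B5a″ (`…PTDeepLocalIndexCoprimeTower`)

HONEST FRAMING (cell `pub/bsd-wall`, W-ALL row 1; width seat `bsd-wall-tp2-p2-w2` g4, `--supports` only). THEOREMS ONLY (no definition, no named
fact, no instance, no `sorry`); closes no item; BSD is NOT proved by any of this.

## What is proved (`K` a number field, `p` prime, `κ : ZpExtension K p`, `v ∤ p` finite, `𝔐 ∈ v.localPrimesAbove`, `F` an arithmetic Frobenius at `𝔐`
## NOT in `D_∞ := localSubgroup κ.kerSubgroup K_v` — no complete splitting; `M` a discrete `p`-primary module with continuous action)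

§1 (any `M`)
* `resOfLe_inertia_localSubgroup_kerSubgroup_injective` (LOCAL form, `M` a `Γ_{K_v}`-module): `res : H¹(D_∞, M) → H¹(I_𝔐, M)` is injective — an
  `M`-class over `K_{∞,η}` unramified at `𝔐` is ZERO.
* `resOfLe_map_inertia_injective` (GLOBAL form, `M` a `Γ_K`-module, subgroups of `Γ_K` through `r = resGal K_v : Γ_{K_v} → Γ_K`):
  `res : H¹(r(D_∞), M) → H¹(r(I_𝔐), M)` is injective, where `r(D_∞) = Gal(K̄/K_∞) ⊓ D_v` (`map_localSubgroup_kerSubgroup_eq`); the index hypothesis of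
  B5a′⁺ is transported along `r` (`Subgroup.relIndex_comap`).
* `resOfLe_kerSubgroup_inf_decomp_eq_zero_of_unramified`: for a class `c ∈ H¹(Gal(K̄/K_∞), M)` whose restriction to `Gal(K̄/K_∞) ⊓ r(I_𝔐)` vanishes,
  the restriction to `Gal(K̄/K_∞) ⊓ D_v` vanishes (`D_v = decomp v`, the image of `Γ_{K_v}`).
§2 `F ∉ D_∞` ⟸ `D_∞ ≠ Γ_{K_v}` (`not_mem_localSubgroup_kerSubgroup_of_ne_top`); for the CYCLOTOMIC `κ` both hold at every `v ∤ p`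
  (`not_mem_localSubgroup_kerSubgroup_of_isCyclotomic`, `localSubgroup_kerSubgroup_ne_top_of_isCyclotomic`, from the tree's
  `ZpExtension.IsCyclotomic.apply_resGal_frobenius_ne_one`; universe `0` like that lemma).
§3 DESCENT TO THE LAYERS for `M = E[p^∞]` (pattern `Kobayashi2003.fineSelmerInfty_le_signedSelmerInfty` §3): `conjH1_mem_localKerOver_layer_of_unramified` —
  `W/K` elliptic, good at `v ∤ p`, `y ∈ H¹(K_m, E[p^∞])`, `σ ∈ Γ_K`, `conj_σ (h_m y)` unramified at the chosen place above `v` ⟹ `conj_σ y` satisfies the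
  CLASSICAL Selmer condition at `v` over the layer `K_m` (`WeierstrassCurve.localKerOver`), via Greenberg's Lemma 3.3 in the tree
  (`Greenberg1999.localTowerKerPrimary_eq_bot_of_hasGoodReductionAt`); canonical forms with `I_v = GreenbergSelmer.inertia v` and the hypothesis
  «`D_∞ ≠ ⊤`» / «`κ` cyclotomic» (`map_inertia_eq_inertia`, `conjH1_mem_localKerOver_layer_of_resOfLe_inertia_eq_zero(_of_isCyclotomic)`).
This is brick B5b COMPLETE («(t3) unramified at good `w ∤ p` ⟹ classical condition at every layer»); B5c (assembly into `signedSelmerLayer` /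
`signedSelmerInfty`) is the next file.

References: [GreenbergLNM1716] §2 (p. 70), §3 Lemma 3.3 (p. 86); [NeukirchANT1999] Ch. II §9 Prop. (9.6), (9.9)–(9.11); [SerreGaloisCohomology1997] I §2.4.
-/

set_option autoImplicit false
-- the Theorems namespace of this sub repeats the summit name by design (D-0017 nested layout)
set_option linter.dupNamespace false

noncomputable section

open scoped Classical NumberField Pointwise

universe u

namespace Summit.BirchSwinnertonDyer.BirchSwinnertonDyer.Theorems

namespace SignedLowerOffTwo.PTDeep

open NumberField IsDedekindDomain Field IsDedekindDomain.HeightOneSpectrum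
  Literature.NumberTheory.EllipticCurves Literature.NumberTheory.GaloisRepresentations
  Literature.NumberTheory.EllipticCurves.GreenbergSelmer

variable {K : Type u} [Field K] [NumberField K] (v : HeightOneSpectrum (𝓞 K)) {p : ℕ} [Fact p.Prime] (κ : ZpExtension K p)
  {𝔐 : Ideal (localAbsIntegers v)} {F : absoluteGaloisGroup (v.adicCompletion K)}

/-- `D_∞ = localSubgroup κ.kerSubgroup K_v` is closed in `Γ_{K_v}`. [folklore] -/
theorem isClosed_localSubgroup_kerSubgroup :
    IsClosed ((localSubgroup κ.kerSubgroup (v.adicCompletion K) : Subgroup (absoluteGaloisGroup (v.adicCompletion K))) :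
      Set (absoluteGaloisGroup (v.adicCompletion K))) :=
  κ.isClosed_kerSubgroup.preimage (map_continuous (resGal (K := K) (v.adicCompletion K)))

/-- **LOCAL FORM: an `M`-class over `K_{∞,η}` unramified at `v ∤ p` is zero** (`M` a discrete `p`-primary `Γ_{K_v}`-module with continuous action):
`res : H¹(D_∞, M) → H¹(I_𝔐, M)` is injective when the Frobenius is not in `D_∞`. (B5a′⁺ `resOfLe_injective_of_forall_isOpen_sup_coprime` fed by B5a″
`relIndex_localSubgroup_kerSubgroup_coprime`.) [cite: GreenbergLNM1716, §2 (p. 70)] [cite: SerreGaloisCohomology1997, I §2.4] -/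
theorem resOfLe_inertia_localSubgroup_kerSubgroup_injective (hpv : (p : 𝓞 K) ∉ v.asIdeal) (h𝔐 : 𝔐 ∈ v.localPrimesAbove)
    (hF : IsArithFrobAt (v.adicCompletionIntegers K) F 𝔐) (hFD : F ∉ localSubgroup κ.kerSubgroup (v.adicCompletion K))
    (M : Type u) [AddCommGroup M] [DistribMulAction (absoluteGaloisGroup (v.adicCompletion K)) M] [TopologicalSpace M] [DiscreteTopology M]
    [ContinuousSMul (absoluteGaloisGroup (v.adicCompletion K)) M] (hM : ∀ m : M, ∃ k : ℕ, p ^ k • m = 0) :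
    Function.Injective (resOfLe M (inertia_le_localSubgroup_kerSubgroup v κ hpv h𝔐) :
      subgroupH1 (localSubgroup κ.kerSubgroup (v.adicCompletion K)) M →
        subgroupH1 (𝔐.inertia (absoluteGaloisGroup (v.adicCompletion K))) M) := by
  haveI : CompactSpace (absoluteGaloisGroup (v.adicCompletion K)) := absoluteGaloisGroup_compactSpace (v.adicCompletion K)
  haveI : TotallyDisconnectedSpace (absoluteGaloisGroup (v.adicCompletion K)) := by
    change TotallyDisconnectedSpace (AlgebraicClosure (v.adicCompletion K) ≃ₐ[v.adicCompletion K] AlgebraicClosure (v.adicCompletion K))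
    infer_instance
  exact resOfLe_injective_of_forall_isOpen_sup_coprime M _ (isClosed_localSubgroup_kerSubgroup v κ) hM
    fun W hIW hW ↦ relIndex_localSubgroup_kerSubgroup_coprime v κ hpv h𝔐 hF hFD hIW hW

/-- `r(D_∞) = Gal(K̄/K_∞) ⊓ D_v` for `r = resGal K_v`, `D_v = decomp v`. [cite: NeukirchANT1999, Ch. II §9 Prop. (9.6)] -/
theorem map_localSubgroup_kerSubgroup_eq :
    (localSubgroup κ.kerSubgroup (v.adicCompletion K)).map (resGal (K := K) (v.adicCompletion K)).toMonoidHom =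
      κ.kerSubgroup ⊓ decomp (K := K) v := by
  rw [localSubgroup_eq_comap, Subgroup.map_comap_eq, inf_comm]
  rfl

/-- **GLOBAL FORM** (subgroups of `Γ_K`, `M` a discrete `p`-primary `Γ_K`-module with continuous action): `res : H¹(r(D_∞), M) → H¹(r(I_𝔐), M)` is
injective, `r = resGal K_v`. The index hypothesis of B5a′⁺ is transported along the injective `r`: for an open `W ≥ r(I_𝔐)` of `Γ_K`,
`[r(D_∞) : W ⊓ r(D_∞)] = [D_∞ : r⁻¹(W) ⊓ D_∞]` (`Subgroup.relIndex_comap`), prime to `p` by B5a″.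
[cite: GreenbergLNM1716, §2 (p. 70)] [cite: SerreGaloisCohomology1997, I §2.4] -/
theorem resOfLe_map_inertia_injective (hpv : (p : 𝓞 K) ∉ v.asIdeal) (h𝔐 : 𝔐 ∈ v.localPrimesAbove)
    (hF : IsArithFrobAt (v.adicCompletionIntegers K) F 𝔐) (hFD : F ∉ localSubgroup κ.kerSubgroup (v.adicCompletion K))
    (M : Type u) [AddCommGroup M] [DistribMulAction (absoluteGaloisGroup K) M] [TopologicalSpace M] [DiscreteTopology M]
    [ContinuousSMul (absoluteGaloisGroup K) M] (hM : ∀ m : M, ∃ k : ℕ, p ^ k • m = 0) :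
    Function.Injective (resOfLe M
      (Subgroup.map_mono (inertia_le_localSubgroup_kerSubgroup v κ hpv h𝔐) :
        (𝔐.inertia (absoluteGaloisGroup (v.adicCompletion K))).map (resGal (K := K) (v.adicCompletion K)).toMonoidHom ≤
          (localSubgroup κ.kerSubgroup (v.adicCompletion K)).map (resGal (K := K) (v.adicCompletion K)).toMonoidHom) :
      subgroupH1 ((localSubgroup κ.kerSubgroup (v.adicCompletion K)).map (resGal (K := K) (v.adicCompletion K)).toMonoidHom) M →
        subgroupH1 ((𝔐.inertia (absoluteGaloisGroup (v.adicCompletion K))).map (resGal (K := K) (v.adicCompletion K)).toMonoidHom) M) := by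
  haveI : CompactSpace (absoluteGaloisGroup K) := absoluteGaloisGroup_compactSpace K
  haveI : TotallyDisconnectedSpace (absoluteGaloisGroup K) := by
    change TotallyDisconnectedSpace (AlgebraicClosure K ≃ₐ[K] AlgebraicClosure K)
    infer_instance
  haveI : CompactSpace (absoluteGaloisGroup (v.adicCompletion K)) := absoluteGaloisGroup_compactSpace (v.adicCompletion K)
  -- `r(D_∞)` is closed (compact image)
  have hDc : IsClosed (((localSubgroup κ.kerSubgroup (v.adicCompletion K)).map (resGal (K := K) (v.adicCompletion K)).toMonoidHom :
      Subgroup (absoluteGaloisGroup K)) : Set (absoluteGaloisGroup K)) := by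
    rw [Subgroup.coe_map]
    exact ((isClosed_localSubgroup_kerSubgroup v κ).isCompact.image (map_continuous (resGal (K := K) (v.adicCompletion K)))).isClosed
  refine resOfLe_injective_of_forall_isOpen_sup_coprime M _ hDc hM fun W hIW hW ↦ ?_
  -- transport the index to the local side
  have hIW' : 𝔐.inertia (absoluteGaloisGroup (v.adicCompletion K)) ≤ W.comap (resGal (K := K) (v.adicCompletion K)).toMonoidHom :=
    fun σ hσ ↦ hIW (Subgroup.mem_map_of_mem _ hσ)
  have hW' : IsOpen ((W.comap (resGal (K := K) (v.adicCompletion K)).toMonoidHom : Subgroup (absoluteGaloisGroup (v.adicCompletion K))) :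
      Set (absoluteGaloisGroup (v.adicCompletion K))) :=
    hW.preimage (map_continuous (resGal (K := K) (v.adicCompletion K)))
  have h := relIndex_localSubgroup_kerSubgroup_coprime v κ hpv h𝔐 hF hFD hIW' hW'
  rw [Subgroup.inf_relIndex_right, Subgroup.relIndex_comap] at h
  rwa [Subgroup.inf_relIndex_right]

/-- **The form consumed by the layer descent**: for a class `c ∈ H¹(Gal(K̄/K_∞), M)` (`M` discrete `p`-primary `Γ_K`-module, continuous action) whose
restriction to `Gal(K̄/K_∞) ⊓ r(I_𝔐)` vanishes («`c` unramified at the place of `K_∞` above `v` singled out by the embedding»), the restriction to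
`Gal(K̄/K_∞) ⊓ D_v` vanishes («`c` locally trivial there»), provided `v ∤ p` does not split completely (`F ∉ D_∞`). [cite: GreenbergLNM1716, §2 (p. 70)] -/
theorem resOfLe_kerSubgroup_inf_decomp_eq_zero_of_unramified (hpv : (p : 𝓞 K) ∉ v.asIdeal) (h𝔐 : 𝔐 ∈ v.localPrimesAbove)
    (hF : IsArithFrobAt (v.adicCompletionIntegers K) F 𝔐) (hFD : F ∉ localSubgroup κ.kerSubgroup (v.adicCompletion K))
    (M : Type u) [AddCommGroup M] [DistribMulAction (absoluteGaloisGroup K) M] [TopologicalSpace M] [DiscreteTopology M]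
    [ContinuousSMul (absoluteGaloisGroup K) M] (hM : ∀ m : M, ∃ k : ℕ, p ^ k • m = 0)
    (c : subgroupH1 κ.kerSubgroup M)
    (hunr : resOfLe M (inf_le_left : κ.kerSubgroup ⊓
        (𝔐.inertia (absoluteGaloisGroup (v.adicCompletion K))).map (resGal (K := K) (v.adicCompletion K)).toMonoidHom ≤ κ.kerSubgroup) c = 0) :
    resOfLe M (inf_le_left : κ.kerSubgroup ⊓ decomp (K := K) v ≤ κ.kerSubgroup) c = 0 := by
  -- the two subgroups in play
  have hB : (localSubgroup κ.kerSubgroup (v.adicCompletion K)).map (resGal (K := K) (v.adicCompletion K)).toMonoidHom =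
      κ.kerSubgroup ⊓ decomp (K := K) v := map_localSubgroup_kerSubgroup_eq v κ
  have hA : (𝔐.inertia (absoluteGaloisGroup (v.adicCompletion K))).map (resGal (K := K) (v.adicCompletion K)).toMonoidHom =
      κ.kerSubgroup ⊓ (𝔐.inertia (absoluteGaloisGroup (v.adicCompletion K))).map (resGal (K := K) (v.adicCompletion K)).toMonoidHom := by
    refine le_antisymm (le_inf ?_ le_rfl) inf_le_right
    exact (Subgroup.map_mono (inertia_le_localSubgroup_kerSubgroup v κ hpv h𝔐)).trans (hB.le.trans inf_le_left)
  have hAB : κ.kerSubgroup ⊓ (𝔐.inertia (absoluteGaloisGroup (v.adicCompletion K))).map (resGal (K := K) (v.adicCompletion K)).toMonoidHom ≤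
      κ.kerSubgroup ⊓ decomp (K := K) v := by
    rw [← hA, ← hB]; exact Subgroup.map_mono (inertia_le_localSubgroup_kerSubgroup v κ hpv h𝔐)
  -- restriction in two steps: `Γ_∞ → Γ_∞ ⊓ D_v → Γ_∞ ⊓ r(I_𝔐)`
  have hinj : Function.Injective (resOfLe M hAB :
      subgroupH1 (κ.kerSubgroup ⊓ decomp (K := K) v) M → subgroupH1 (κ.kerSubgroup ⊓
        (𝔐.inertia (absoluteGaloisGroup (v.adicCompletion K))).map (resGal (K := K) (v.adicCompletion K)).toMonoidHom) M) :=
    resOfLe_injective_congr M hA hB _ hAB (resOfLe_map_inertia_injective v κ hpv h𝔐 hF hFD M hM)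
  refine hinj ?_
  rw [map_zero, ← AddMonoidHom.comp_apply, resOfLe_comp_holds (M := M) hAB inf_le_left]
  exact hunr

/-! ## No complete splitting: the hypothesis `F ∉ D_∞` -/

/-- **`F ∉ D_∞` as soon as `v` does not split completely in `K_∞/K`** (`D_∞ ≠ Γ_{K_v}`): `D_∞` is closed and contains `I_𝔐`; if it also contained
`F` it would contain `F^ℕ · I_𝔐 · U` for every open subgroup `U` (Frobenius generation `exists_eq_frobenius_pow_mul_inertia_mul`), i.e. be dense.
[cite: NeukirchANT1999, Ch. II §9 Prop. (9.9)–(9.11)] -/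
theorem not_mem_localSubgroup_kerSubgroup_of_ne_top (hpv : (p : 𝓞 K) ∉ v.asIdeal) (h𝔐 : 𝔐 ∈ v.localPrimesAbove)
    (hF : IsArithFrobAt (v.adicCompletionIntegers K) F 𝔐)
    (hD : localSubgroup κ.kerSubgroup (v.adicCompletion K) ≠ ⊤) :
    F ∉ localSubgroup κ.kerSubgroup (v.adicCompletion K) := by
  intro hFD
  haveI : CompactSpace (absoluteGaloisGroup (v.adicCompletion K)) := absoluteGaloisGroup_compactSpace (v.adicCompletion K)
  haveI : TotallyDisconnectedSpace (absoluteGaloisGroup (v.adicCompletion K)) := by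
    change TotallyDisconnectedSpace (AlgebraicClosure (v.adicCompletion K) ≃ₐ[v.adicCompletion K] AlgebraicClosure (v.adicCompletion K))
    infer_instance
  refine hD (eq_top_iff.mpr fun σ _ ↦ ?_)
  have hmem : σ ∈ closure ((localSubgroup κ.kerSubgroup (v.adicCompletion K) : Subgroup (absoluteGaloisGroup (v.adicCompletion K))) :
      Set (absoluteGaloisGroup (v.adicCompletion K))) := by
    rw [mem_closure_iff]
    intro O hO hσO
    have hO' : IsOpen ((fun g ↦ σ * g) ⁻¹' O) := hO.preimage (continuous_const_mul σ)
    obtain ⟨U, hU⟩ := ProfiniteGrp.exist_openNormalSubgroup_sub_open_nhds_of_one hO' (by simpa using hσO)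
    obtain ⟨n, τ, u, hτ, hu, hστ⟩ := exists_eq_frobenius_pow_mul_inertia_mul v h𝔐 hF U.isOpen σ
    refine ⟨σ * u⁻¹, hU (inv_mem hu), ?_⟩
    rw [hστ, mul_inv_cancel_right]
    exact mul_mem (pow_mem hFD n) (inertia_le_localSubgroup_kerSubgroup v κ hpv h𝔐 hτ)
  rwa [(isClosed_localSubgroup_kerSubgroup v κ).closure_eq] at hmem

/-! ## Descent to the layers: the CLASSICAL local condition at a good `v ∤ p` for a layer class unramified over `K_∞` -/

omit [NumberField K] [Fact p.Prime] in
/-- `Γ_K` acts continuously on the discrete module `E[p^∞]`. [folklore] -/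
theorem continuousSMul_geomPrimaryTorsion (W : WeierstrassCurve K) :
    ContinuousSMul (absoluteGaloisGroup K) (W.geomPrimaryTorsion p) :=
  ⟨continuous_prod_of_discrete_right.mpr fun b ↦ W.continuous_smul_geomPrimaryTorsion p b⟩

omit [NumberField K] [Fact p.Prime] in
/-- Elements of `E[p^∞]` are `p`-power torsion (as `ℕ`-scalars). [folklore] -/
theorem exists_pow_smul_eq_zero_geomPrimaryTorsion (W : WeierstrassCurve K) (m : W.geomPrimaryTorsion p) :
    ∃ k : ℕ, p ^ k • m = 0 := by
  obtain ⟨k, hk⟩ := m.2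
  exact ⟨k, Subtype.ext (by rw [AddSubgroupClass.coe_nsmul, hk, ZeroMemClass.coe_zero])⟩

/-- **B5b for `E[p^∞]`, layer form (the classical Selmer condition at a good `v ∤ p`).** `W/K` elliptic with good reduction at `v ∤ p`,
`v` not split completely in `K_∞` (`F ∉ D_∞`); `y ∈ H¹(K_m, E[p^∞])`, `σ ∈ Γ_K`. If `conj_σ (h_m y) ∈ H¹(K_∞, E[p^∞])` is UNRAMIFIED at the chosen
place above `v` (its restriction to `Gal(K̄/K_∞) ⊓ r(I_𝔐)` vanishes), then `conj_σ y` satisfies the classical local condition at `v` over the LAYER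
`K_m` (`WeierstrassCurve.localKerOver`: dies in `H¹(Gal(K̄_v/K_m·K_v), E(K̄_v))`). Chain: unramified ⟹ zero on `Gal(K̄/K_∞) ⊓ D_v`
(`resOfLe_kerSubgroup_inf_decomp_eq_zero_of_unramified`) ⟹ local condition over `K_∞` (`Kobayashi2003.mem_localKerOver_of_resOfLe_inf_eq_zero`)
⟹ `loc (conj_σ y) ∈ 𝒦_{v,m}[p^∞]` (`localResOver_conjH1_mem_localTowerKer`; layer classes are `p`-power torsion) `= 0` (Greenberg's Lemma 3.3,
`Greenberg1999.localTowerKerPrimary_eq_bot_of_hasGoodReductionAt`). [cite: GreenbergLNM1716, §2 (p. 70) and §3 Lemma 3.3 (p. 86)] -/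
theorem conjH1_mem_localKerOver_layer_of_unramified (W : WeierstrassCurve K) [W.IsElliptic] (hpv : (p : 𝓞 K) ∉ v.asIdeal)
    (hgood : W.HasGoodReductionAt v) (h𝔐 : 𝔐 ∈ v.localPrimesAbove) (hF : IsArithFrobAt (v.adicCompletionIntegers K) F 𝔐)
    (hFD : F ∉ localSubgroup κ.kerSubgroup (v.adicCompletion K)) {m : ℕ} (y : W.subgroupH1 p (κ.layerSubgroup m))
    (σ : absoluteGaloisGroup K)
    (hunr : resOfLe (W.geomPrimaryTorsion p) (inf_le_left : κ.kerSubgroup ⊓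
        (𝔐.inertia (absoluteGaloisGroup (v.adicCompletion K))).map (resGal (K := K) (v.adicCompletion K)).toMonoidHom ≤ κ.kerSubgroup)
        (W.conjH1 p κ.kerSubgroup σ (W.layerToInfty κ m y)) = 0) :
    W.conjH1 p (κ.layerSubgroup m) σ y ∈ W.localKerOver p (κ.layerSubgroup m) (v.adicCompletion K) := by
  haveI := continuousSMul_geomPrimaryTorsion (p := p) W
  -- over `K_∞`: zero on `Gal(K̄/K_∞) ⊓ D_v`, hence the local condition there
  have h0 := resOfLe_kerSubgroup_inf_decomp_eq_zero_of_unramified v κ hpv h𝔐 hF hFD (W.geomPrimaryTorsion p)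
    (exists_pow_smul_eq_zero_geomPrimaryTorsion (p := p) W) _ hunr
  have hinf : W.conjH1 p κ.kerSubgroup σ (W.layerToInfty κ m y) ∈ W.localKerOver p κ.kerSubgroup (v.adicCompletion K) :=
    Kobayashi2003.mem_localKerOver_of_resOfLe_inf_eq_zero W p (Kobayashi2003.resGalOfEmb_mem_decomp v) h0
  -- descent to the layer: `loc (conj_σ y) ∈ 𝒦_{v,m}[p^∞] = 0`
  have htow := W.localResOver_conjH1_mem_localTowerKer κ (v.adicCompletion K) _ σ hinf
  obtain ⟨k, hk⟩ : ∃ k : ℕ, p ^ k • W.conjH1 p (κ.layerSubgroup m) σ y = 0 := by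
    haveI : CompactSpace (κ.layerSubgroup m) := isCompact_iff_compactSpace.mp
      ((κ.layerSubgroup m).isClosed_of_isOpen (κ.isOpen_layerSubgroup m)).isCompact
    obtain ⟨ψ, hψ⟩ := oneCocycleClass_surjective _ (W.conjH1 p (κ.layerSubgroup m) σ y)
    obtain ⟨k, hk⟩ := IwasawaDual.exists_pow_smul_oneCocycleClass_eq_zero (p := p) ψ
      fun τ ↦ exists_pow_smul_eq_zero_geomPrimaryTorsion (p := p) W (ψ.1 τ)
    exact ⟨k, by rw [← hψ]; exact hk⟩
  have hprimary : W.localResOver p (κ.layerSubgroup m) (v.adicCompletion K) (W.conjH1 p (κ.layerSubgroup m) σ y) ∈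
      W.localTowerKerPrimary κ (v.adicCompletion K) m :=
    (W.mem_localTowerKerPrimary_iff κ (v.adicCompletion K) m _).2 ⟨htow, k, by rw [← map_nsmul, hk, map_zero]⟩
  rw [Greenberg1999.localTowerKerPrimary_eq_bot_of_hasGoodReductionAt W κ hpv hgood m, AddSubgroup.mem_bot] at hprimary
  rw [WeierstrassCurve.mem_localKerOver_iff]
  exact hprimary


/-! ## Canonical forms: `r(I_𝔐) = I_v` (`GreenbergSelmer.inertia`), and the hypothesis «`v` not split completely in `K_∞`» -/

/-- Transport of `res c = 0` along an equality of the subgroup restricted to. [folklore] -/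
theorem resOfLe_eq_zero_congr {G : Type u} [Group G] [TopologicalSpace G] [IsTopologicalGroup G]
    (M : Type u) [AddCommGroup M] [DistribMulAction G M] [TopologicalSpace M] [DiscreteTopology M]
    {A₁ A₂ B : Subgroup G} (hA : A₁ = A₂) (h₁ : A₁ ≤ B) (h₂ : A₂ ≤ B) {c : subgroupH1 B M} (hc : resOfLe M h₁ c = 0) :
    resOfLe M h₂ c = 0 := by
  subst hA
  exact hc

/-- **`r(I_𝔐) = I_v`**: the image in `Γ_K` of the inertia group of any prime `𝔐 ∈ v.localPrimesAbove` is the tree's canonical inertia group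
`GreenbergSelmer.inertia v = r(absInertia K_v)` (`HeightOneSpectrum.inertia_eq_absInertia`). [cite: NeukirchANT1999, Ch. II §9 (9.3), Prop. (9.6)] -/
theorem map_inertia_eq_inertia (h𝔐 : 𝔐 ∈ v.localPrimesAbove) :
    (𝔐.inertia (absoluteGaloisGroup (v.adicCompletion K))).map (resGal (K := K) (v.adicCompletion K)).toMonoidHom =
      GreenbergSelmer.inertia (K := K) v := by
  obtain ⟨w, hw⟩ := v.exists_spectralValuation
  rw [HeightOneSpectrum.inertia_eq_absInertia hw h𝔐]
  rfl

/-- **B5b for `E[p^∞]`, CANONICAL layer form** (no choice of `𝔐`, `F`): `W/K` elliptic, good at `v ∤ p`, `v` NOT split completely in `K_∞/K`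
(`D_∞ ≠ Γ_{K_v}`); if `conj_σ (h_m y)` restricted to `Gal(K̄/K_∞) ⊓ I_v` vanishes (`I_v = GreenbergSelmer.inertia v`), then `conj_σ y` satisfies the
classical local condition at `v` over `K_m`. [cite: GreenbergLNM1716, §2 (p. 70) and §3 Lemma 3.3 (p. 86)] -/
theorem conjH1_mem_localKerOver_layer_of_resOfLe_inertia_eq_zero (W : WeierstrassCurve K) [W.IsElliptic] (hpv : (p : 𝓞 K) ∉ v.asIdeal)
    (hgood : W.HasGoodReductionAt v) (hD : localSubgroup κ.kerSubgroup (v.adicCompletion K) ≠ ⊤) {m : ℕ}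
    (y : W.subgroupH1 p (κ.layerSubgroup m)) (σ : absoluteGaloisGroup K)
    (hunr : resOfLe (W.geomPrimaryTorsion p) (inf_le_left : κ.kerSubgroup ⊓ GreenbergSelmer.inertia (K := K) v ≤ κ.kerSubgroup)
        (W.conjH1 p κ.kerSubgroup σ (W.layerToInfty κ m y)) = 0) :
    W.conjH1 p (κ.layerSubgroup m) σ y ∈ W.localKerOver p (κ.layerSubgroup m) (v.adicCompletion K) := by
  obtain ⟨𝔐, h𝔐⟩ := v.localPrimesAbove_nonempty
  obtain ⟨F, hF⟩ := exists_isArithFrobAt_localAbsIntegers v h𝔐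
  refine conjH1_mem_localKerOver_layer_of_unramified v κ W hpv hgood h𝔐 hF
    (not_mem_localSubgroup_kerSubgroup_of_ne_top v κ hpv h𝔐 hF hD) y σ ?_
  exact resOfLe_eq_zero_congr (W.geomPrimaryTorsion p) (by rw [map_inertia_eq_inertia v h𝔐]) _ _ hunr

/-! ## The cyclotomic `ℤ_p`-extension (universe `0`, as the tree's `ZpExtension.IsCyclotomic.apply_resGal_frobenius_ne_one`) -/

section Cyclotomic

variable {K : Type} [Field K] [NumberField K] (v : HeightOneSpectrum (𝓞 K)) {p : ℕ} [Fact p.Prime] (κ : ZpExtension K p)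
  {𝔐 : Ideal (localAbsIntegers v)} {F : absoluteGaloisGroup (v.adicCompletion K)}

/-- **For the cyclotomic `ℤ_p`-extension no finite `v ∤ p` splits completely: `F ∉ D_∞`** (`κ(F|_{K̄}) ≠ 1`, the tree's
`ZpExtension.IsCyclotomic.apply_resGal_frobenius_ne_one`). [cite: GreenbergLNM1716, §1] [cite: Washington1997, §13.1] -/
theorem not_mem_localSubgroup_kerSubgroup_of_isCyclotomic (hκ : κ.IsCyclotomic) (hpv : (p : 𝓞 K) ∉ v.asIdeal)
    (h𝔐 : 𝔐 ∈ v.localPrimesAbove) (hF : IsArithFrobAt (v.adicCompletionIntegers K) F 𝔐) :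
    F ∉ localSubgroup κ.kerSubgroup (v.adicCompletion K) := fun h ↦
  ZpExtension.IsCyclotomic.apply_resGal_frobenius_ne_one hκ hpv h𝔐 hF (toAdd_eq_zero.mp ((mem_localSubgroup_kerSubgroup_iff v κ F).mp h))

/-- **Cyclotomic corollary** (`K_∞ = K^{cyc}`: no `F ∉ D_∞` hypothesis). [cite: GreenbergLNM1716, §2 (p. 70) and §3 Lemma 3.3 (p. 86)] -/
theorem conjH1_mem_localKerOver_layer_of_unramified_of_isCyclotomic (W : WeierstrassCurve K) [W.IsElliptic] (hκ : κ.IsCyclotomic)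
    (hpv : (p : 𝓞 K) ∉ v.asIdeal) (hgood : W.HasGoodReductionAt v) (h𝔐 : 𝔐 ∈ v.localPrimesAbove)
    (hF : IsArithFrobAt (v.adicCompletionIntegers K) F 𝔐) {m : ℕ} (y : W.subgroupH1 p (κ.layerSubgroup m)) (σ : absoluteGaloisGroup K)
    (hunr : resOfLe (W.geomPrimaryTorsion p) (inf_le_left : κ.kerSubgroup ⊓
        (𝔐.inertia (absoluteGaloisGroup (v.adicCompletion K))).map (resGal (K := K) (v.adicCompletion K)).toMonoidHom ≤ κ.kerSubgroup)
        (W.conjH1 p κ.kerSubgroup σ (W.layerToInfty κ m y)) = 0) :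
    W.conjH1 p (κ.layerSubgroup m) σ y ∈ W.localKerOver p (κ.layerSubgroup m) (v.adicCompletion K) :=
  conjH1_mem_localKerOver_layer_of_unramified v κ W hpv hgood h𝔐 hF (not_mem_localSubgroup_kerSubgroup_of_isCyclotomic v κ hκ hpv h𝔐 hF)
    y σ hunr

/-- **For the cyclotomic `ℤ_p`-extension, `D_∞ ≠ Γ_{K_v}` at every finite `v ∤ p`** (no finite place splits completely in `K^{cyc}_∞/K`).
[cite: GreenbergLNM1716, §1] [cite: Washington1997, §13.1] -/
theorem localSubgroup_kerSubgroup_ne_top_of_isCyclotomic (hκ : κ.IsCyclotomic) (hpv : (p : 𝓞 K) ∉ v.asIdeal) :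
    localSubgroup κ.kerSubgroup (v.adicCompletion K) ≠ ⊤ := by
  obtain ⟨𝔐, h𝔐⟩ := v.localPrimesAbove_nonempty
  obtain ⟨F, hF⟩ := exists_isArithFrobAt_localAbsIntegers v h𝔐
  intro htop
  exact not_mem_localSubgroup_kerSubgroup_of_isCyclotomic v κ hκ hpv h𝔐 hF (htop ▸ Subgroup.mem_top F)

/-- **B5b for `E[p^∞]` over the cyclotomic tower, CANONICAL layer form**: good `v ∤ p`, `conj_σ (h_m y)` zero on `Gal(K̄/K_∞) ⊓ I_v` ⟹ `conj_σ y`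
satisfies the classical local condition at `v` over `K_m`. [cite: GreenbergLNM1716, §2 (p. 70) and §3 Lemma 3.3 (p. 86)] -/
theorem conjH1_mem_localKerOver_layer_of_resOfLe_inertia_eq_zero_of_isCyclotomic (W : WeierstrassCurve K) [W.IsElliptic]
    (hκ : κ.IsCyclotomic) (hpv : (p : 𝓞 K) ∉ v.asIdeal) (hgood : W.HasGoodReductionAt v) {m : ℕ}
    (y : W.subgroupH1 p (κ.layerSubgroup m)) (σ : absoluteGaloisGroup K)
    (hunr : resOfLe (W.geomPrimaryTorsion p) (inf_le_left : κ.kerSubgroup ⊓ GreenbergSelmer.inertia (K := K) v ≤ κ.kerSubgroup)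
        (W.conjH1 p κ.kerSubgroup σ (W.layerToInfty κ m y)) = 0) :
    W.conjH1 p (κ.layerSubgroup m) σ y ∈ W.localKerOver p (κ.layerSubgroup m) (v.adicCompletion K) :=
  conjH1_mem_localKerOver_layer_of_resOfLe_inertia_eq_zero v κ W hpv hgood (localSubgroup_kerSubgroup_ne_top_of_isCyclotomic v κ hκ hpv)
    y σ hunr

end Cyclotomic

end SignedLowerOffTwo.PTDeep

end Summit.BirchSwinnertonDyer.BirchSwinnertonDyer.Theorems

end
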